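import Summits.Schanuel.Schanuel.Theorems.RootDecomp1HGauge
import Summits.Schanuel.Schanuel.Theorems.RootDecomp1HMirrorItems
import Mathlib.RingTheory.MvPolynomial.Tower

/-!
# RootDecomp1H / RootDecomp1HSigma — ROUND 14 «TWIST» (cell decomp-schanuel, lens 5, generation 14), kernel part:
# SUBSTITUTION ALONG THE FORMS — the instrument's certificate at ANY presented point, with NO hypothesis consumed

Port target `Summits/Schanuel/Schanuel/Theorems/RootDecomp1HSubst.lean` (namespace `…Theorems.RootDecomp1HSubst`);
`--supports` the instrument items `FinCS` (stmt-Schanuel-27287) / `FinCSSigma` (sibling route `RootDecomp1HSigma`).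

## What is proved (0 sorry)

§1  For a tuple `y ∈ ℂⁿ`, rational polynomials `L₁ … L_n ∈ ℚ[X, Y]` vanishing at `p = (y, eʸ)` (the PRESENTATION of the
    cell point — any size, any rank) and a `ℚ`-algebra endomorphism `φ` of `ℚ[X, Y]` that moves every variable ALONG THE
    FORMS (`X_s − φ(X_s) ∈ (L₁, …, L_n)`, e.g. the affine PIVOT SUBSTITUTION solving the forms for `n` of the `2n`
    coordinates), the TANGENT LEMMA `grad_p Q − grad_p φ(Q) ∈ T = span_ℂ {grad_p L_k}` (Leibniz induction) and hence
    **`no_certificate_of_substExcl`**: if every integer polynomial of size `≤ N` vanishing at `p` is KILLED by `φ`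
    (`SubstExcl φ y N` — the census predicate: «no non-trivial small relation among the free coordinates»), then NO transverse
    integer certificate of size `≤ N` exists at `y` (its `n + 1` gradients would lie in the `n`-plane `T`).
    This is the cyclic kernel `RootDecomp1HCycles.no_certificate_of_srcExcl` (3-cycles, K10) / `RootDecomp1HSpineSubst` (N-cycles,
    K11) freed from the cycle shape: ONE theorem serves every presented point of every cell — in particular the TWISTED
    (`σ`-stable, non-real) points of cell `(3,1)` enumerated by census TWIST31 (this round) and the REACH31 candidates.
§2  **THE CERTIFICATES CONSUME NOTHING** (critic R14 (a), asked explicitly): `cell_clean_of_substExcl` is stated with THREE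
    ARBITRARY propositional binders `H₁ → H₂ → H₃ → (¬ ℚ-free ∨ no certificate)`; the 1H reading (`LowerRanks n`, `NearOpt`,
    `ConjStable`: item `FinCS` = `FinCSAt stdGauge`) and the Σ reading (`ConjLowerRanks n`: item `FinCSSigma`/`FinCSσ`) are the
    SAME term.  So no certificate in the instrument family uses Schanuel below `n`, σ-stable or not; the residual's cell
    reading `bridge_cell_iff_subst` passes the lower-rank binder through untouched (both readings).
§3  **RANKS ≤ 2 ARE SETTLED BY THE STRUCTURAL BINDERS** (`lowerRanks_three_of_structural`): under `ProductSchanuel ∧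
    RelTowerSchanuel` every `ℚ`-free pair satisfies Schanuel (a rank-`≤ 2` counterexample is itself a tower tuple —
    `towerTuple_of_counterEx_rank_le_two` — and the hull theorem forbids it), so in the Σ-deciding theorem `closesSigma` the
    instrument's rank-`≤ 2` cells (`(2,1)`, `(2,2)`, …) are invoked only on a branch the glue has already closed: the
    load-bearing instrument frontier is rank `3` (critic R14 (c): the `(2,2)` span-first enumeration is an instrument
    exercise, not a cone obligation — NODE-g14 §4).
§4  **THE IMAGINARY-AXIS PIN** (`imagAxis_pin`): `a θ + b sin θ = 0` with `a, b ∈ {0, ±1}` not both `0` and `θ ≠ 0` forces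
    `a = 0 ∧ sin θ = 0`; so a size-`1` form meeting a coordinate on the imaginary axis while the others are real pins it to
    `iπℤ` (`e^{y₃} = ±1`, depth one ⇒ tower hull): the `diag(1,1,−1)`-type σ-stable points of cell `(3,1)` are hull points, and
    the only σ-stable NON-REAL sub-cells of `(3,1)` that can meet the residual are the TWISTED ones `(w, w̄, x)` (NODE-g14 §1).
§5  **PORT TEMPLATE `TwistB0`**: one twisted type-B pilot system carried symbolically through §1–§2 — forms `twL`, the
    UNIMODULAR pivot substitution `twG` (pivots `X₁, X₃, Y₃`; free `y₂, e^{y₁}, e^{y₂}`), ideal identities `hid` by `ring`,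
    `TwistB0.cell_clean` = its `FinCS`/`FinCSSigma` cell instance from the single census fact `SubstExcl (aeval twG) y N`.
    Non-unimodular pivots (`|det| ∈ {2,3,4}`, about 6 %/25 % of the pilot candidate systems) use `alongForms_of_coeffs_scaled`.

lens-5 seat planner-decomp-schanuel-lens-5-g14-0; 0 sorry; axioms ⊆ {propext, Classical.choice, Quot.sound}.
PORT (census-1 gen 8, T14a, critic VERDICT 2026-08-30T16:40:09Z): verbatim; §5 (the `TwistB0` template) is split off into
`RootDecomp1HSubstTwist.lean` for the 400-line lint only.
-/

set_option linter.dupNamespace false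

noncomputable section

namespace Summit.Schanuel.Schanuel.Theorems.RootDecomp1HSubst

open Complex Set
open Literature.NumberTheory.Transcendental (SchanuelRank)
open Summit.Schanuel.Schanuel.Theses.RootDecomp1H (ProductSchanuel RelTowerSchanuel BridgeTransverse FinCS)
open Summit.Schanuel.Schanuel.Theorems.RootDecomp1HClearance (LowerRanks CounterEx InTowerHull
  towerTuple_of_counterEx_rank_le_two)
open Summit.Schanuel.Schanuel.Theorems.RootDecomp1HHull (not_lt_of_inTowerHull)
open Summit.Schanuel.Schanuel.Theorems.RootDecomp1HGauge

variable {n : ℕ}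

/-! ## §1 Substitution along the forms and the tangent lemma -/

/-- Rational polynomials in the `2n` coordinates `X = inl` (the `y_j`) and `Y = inr` (the `e^{y_j}`). -/
abbrev QPoly (n : ℕ) := MvPolynomial (Fin n ⊕ Fin n) ℚ

/-- The point `p = (y, eʸ) ∈ ℂ^{2n}`. -/
def pt (y : Fin n → ℂ) : Fin n ⊕ Fin n → ℂ := Sum.elim y (cexp ∘ y)

/-- Gradient of a rational polynomial at `(y, eʸ)`. -/
def gradQ (Q : QPoly n) (y : Fin n → ℂ) : Fin n ⊕ Fin n → ℂ :=
  fun s => MvPolynomial.aeval (pt y) (MvPolynomial.pderiv s Q)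

/-- The TANGENT PLANE of the presentation: the `ℂ`-span of the gradients of the forms `L_k` at `(y, eʸ)`. -/
def tangent (L : Fin n → QPoly n) (y : Fin n → ℂ) : Submodule ℂ (Fin n ⊕ Fin n → ℂ) :=
  Submodule.span ℂ (Set.range fun k => gradQ (L k) y)

/-- `φ` is a SUBSTITUTION ALONG THE FORMS `L` at `y`: the forms vanish at `(y, eʸ)` and `φ` moves every variable inside the
ideal they generate (e.g. the affine pivot substitution of a presented system). -/
def AlongForms (L : Fin n → QPoly n) (φ : QPoly n →ₐ[ℚ] QPoly n) (y : Fin n → ℂ) : Prop :=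
  (∀ k, MvPolynomial.aeval (pt y) (L k) = 0) ∧
    ∀ s, MvPolynomial.X s - φ (MvPolynomial.X s) ∈ Ideal.span (Set.range L)

/-- THE CENSUS PREDICATE `SubstExcl φ y N`: every integer polynomial of size `≤ N` vanishing at `(y, eʸ)` is killed by `φ`
(for a pivot substitution: its image is a polynomial in the free coordinates only, of degree `≤ N` and bounded height, so
a certified absence of such relations among the free coordinates — LLL exclusion — gives `SubstExcl`). -/
def SubstExcl (φ : QPoly n →ₐ[ℚ] QPoly n) (y : Fin n → ℂ) (N : ℕ) : Prop :=
  ∀ P : MvPolynomial (Fin n ⊕ Fin n) ℤ, psize P ≤ N → MvPolynomial.aeval (pt y) P = 0 →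
    φ (MvPolynomial.map (algebraMap ℤ ℚ) P) = 0

variable {L : Fin n → QPoly n} {φ : QPoly n →ₐ[ℚ] QPoly n} {y : Fin n → ℂ}

/-- HOW A CENSUS PORT BUILDS ONE: give the images `g s` of the `2n` variables (the substitution `φ = aeval g`) and, for
each variable, ring coefficients exhibiting `X_s − g_s` in the ideal of the forms — a polynomial identity per variable,
checked by `ring` (for the affine pivot substitution of a presented size-`1` system the coefficients are the CONSTANTS of
the inverse pivot minor). -/
theorem alongForms_of_coeffs (L : Fin n → QPoly n) (g : Fin n ⊕ Fin n → QPoly n)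
    (coef : Fin n ⊕ Fin n → Fin n → QPoly n) (hid : ∀ s, MvPolynomial.X s - g s = ∑ k, coef s k * L k)
    (hy : ∀ k, MvPolynomial.aeval (pt y) (L k) = 0) : AlongForms L (MvPolynomial.aeval g) y := by
  refine ⟨hy, fun s => ?_⟩
  rw [MvPolynomial.aeval_X, hid s]
  exact Ideal.sum_mem _ fun k _ => Ideal.mul_mem_left _ _ (Ideal.subset_span ⟨k, rfl⟩)

/-- SCALED BUILDER for a non-unimodular pivot (minor determinant `d ∈ {±2, ±3, ±4}`): the census proves the INTEGRAL
identities `d·X_s − g'_s = Σ_k coef_{s,k} L_k` by `ring`; the substitution is `X_s ↦ d⁻¹·g'_s`. -/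
theorem alongForms_of_coeffs_scaled (L : Fin n → QPoly n) (d : ℤ) (hd : d ≠ 0) (g' : Fin n ⊕ Fin n → QPoly n)
    (coef : Fin n ⊕ Fin n → Fin n → QPoly n)
    (hid : ∀ s, (d : QPoly n) * MvPolynomial.X s - g' s = ∑ k, coef s k * L k)
    (hy : ∀ k, MvPolynomial.aeval (pt y) (L k) = 0) :
    AlongForms L (MvPolynomial.aeval fun s => MvPolynomial.C ((d : ℚ)⁻¹) * g' s) y := by
  refine ⟨hy, fun s => ?_⟩
  have hC : MvPolynomial.C ((d : ℚ)⁻¹) * (d : QPoly n) = 1 := by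
    rw [← map_intCast (MvPolynomial.C : ℚ →+* QPoly n) d, ← map_mul, inv_mul_cancel₀ (Int.cast_ne_zero.mpr hd),
      map_one]
  have key : MvPolynomial.X s - MvPolynomial.C ((d : ℚ)⁻¹) * g' s =
      MvPolynomial.C ((d : ℚ)⁻¹) * ((d : QPoly n) * MvPolynomial.X s - g' s) := by
    linear_combination (-(MvPolynomial.X s : QPoly n)) * hC
  rw [MvPolynomial.aeval_X, key, hid s, Finset.mul_sum]
  exact Ideal.sum_mem _ fun k _ => by
    rw [← mul_assoc]; exact Ideal.mul_mem_left _ _ (Ideal.subset_span ⟨k, rfl⟩)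

/-- Members of the ideal of the forms vanish at the point. -/
theorem aeval_eq_zero_of_mem_ideal (h : AlongForms L φ y) {Q : QPoly n} (hQ : Q ∈ Ideal.span (Set.range L)) :
    MvPolynomial.aeval (pt y) Q = 0 := by
  induction hQ using Submodule.span_induction with
  | mem Q hQ =>
    obtain ⟨k, rfl⟩ := hQ
    exact h.1 k
  | zero => exact map_zero _
  | add P Q _ _ hP hQ => rw [map_add, hP, hQ, add_zero]
  | smul a Q _ hQ => rw [smul_eq_mul, map_mul, hQ, mul_zero]

/-- The substitution does not change values at the point: `φ(Q)(p) = Q(p)`. -/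
theorem aeval_subst (h : AlongForms L φ y) (Q : QPoly n) :
    MvPolynomial.aeval (pt y) (φ Q) = MvPolynomial.aeval (pt y) Q := by
  have hX : ∀ s, MvPolynomial.aeval (pt y) (φ (MvPolynomial.X s)) =
      MvPolynomial.aeval (pt y) (MvPolynomial.X s : QPoly n) := by
    intro s
    have h0 := aeval_eq_zero_of_mem_ideal h (h.2 s)
    rw [map_sub, sub_eq_zero] at h0
    exact h0.symm
  have hcomp : (MvPolynomial.aeval (pt y) : QPoly n →ₐ[ℚ] ℂ).comp φ = MvPolynomial.aeval (pt y) :=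
    MvPolynomial.algHom_ext fun s => by rw [AlgHom.comp_apply]; exact hX s
  exact AlgHom.congr_fun hcomp Q

/-- `gradQ (P + Q) y = gradQ P y + gradQ Q y`. -/
theorem gradQ_add (P Q : QPoly n) : gradQ (P + Q) y = gradQ P y + gradQ Q y := by
  funext s; simp [gradQ]

/-- `gradQ (P - Q) y = gradQ P y - gradQ Q y`. -/
theorem gradQ_sub (P Q : QPoly n) : gradQ (P - Q) y = gradQ P y - gradQ Q y := by
  funext s; simp [gradQ]

/-- `gradQ (0 : QPoly n) y = 0`. -/
theorem gradQ_zero : gradQ (0 : QPoly n) y = 0 := by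
  funext s; simp [gradQ]

/-- `gradQ (MvPolynomial.C a : QPoly n) y = 0`. -/
theorem gradQ_C (a : ℚ) : gradQ (MvPolynomial.C a : QPoly n) y = 0 := by
  funext s; simp [gradQ]

/-- Leibniz. -/
theorem gradQ_mul (P Q : QPoly n) :
    gradQ (P * Q) y = MvPolynomial.aeval (pt y) P • gradQ Q y + MvPolynomial.aeval (pt y) Q • gradQ P y := by
  funext s
  simp only [gradQ, MvPolynomial.pderiv_mul, map_add, map_mul, Pi.add_apply, Pi.smul_apply, smul_eq_mul]
  ring

/-- Gradients of ideal members lie in the tangent plane (and ideal members vanish at the point). -/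
theorem gradQ_mem_of_mem_ideal (h : AlongForms L φ y) {Q : QPoly n} (hQ : Q ∈ Ideal.span (Set.range L)) :
    gradQ Q y ∈ tangent L y := by
  suffices hh : MvPolynomial.aeval (pt y) Q = 0 ∧ gradQ Q y ∈ tangent L y from hh.2
  induction hQ using Submodule.span_induction with
  | mem Q hQ =>
    obtain ⟨k, rfl⟩ := hQ
    exact ⟨h.1 k, Submodule.subset_span ⟨k, rfl⟩⟩
  | zero => exact ⟨map_zero _, by rw [gradQ_zero]; exact zero_mem _⟩
  | add P Q _ _ hP hQ =>
    refine ⟨by rw [map_add, hP.1, hQ.1, add_zero], ?_⟩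
    rw [gradQ_add]; exact add_mem hP.2 hQ.2
  | smul a Q _ hQ =>
    refine ⟨by rw [smul_eq_mul, map_mul, hQ.1, mul_zero], ?_⟩
    rw [smul_eq_mul, gradQ_mul, hQ.1, zero_smul, add_zero]
    exact Submodule.smul_mem _ _ hQ.2

/-- **THE TANGENT LEMMA**: for every rational polynomial `Q`, `grad_p Q − grad_p φ(Q)` lies in the tangent plane. -/
theorem gradQ_sub_gradQ_subst_mem (h : AlongForms L φ y) (Q : QPoly n) :
    gradQ Q y - gradQ (φ Q) y ∈ tangent L y := by
  induction Q using MvPolynomial.induction_on with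
  | C a =>
    have hC : φ (MvPolynomial.C a) = MvPolynomial.C a := MvPolynomial.algHom_C φ a
    rw [hC, sub_self]; exact zero_mem _
  | add p q hp hq =>
    rw [map_add, gradQ_add, gradQ_add, add_sub_add_comm]
    exact add_mem hp hq
  | mul_X p s hp =>
    have hX : gradQ (MvPolynomial.X s : QPoly n) y - gradQ (φ (MvPolynomial.X s)) y ∈ tangent L y := by
      rw [← gradQ_sub]; exact gradQ_mem_of_mem_ideal h (h.2 s)
    rw [map_mul, gradQ_mul, gradQ_mul, aeval_subst h, aeval_subst h]
    convert add_mem (Submodule.smul_mem _ (MvPolynomial.aeval (pt y) p) hX)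
      (Submodule.smul_mem _ (MvPolynomial.aeval (pt y) (MvPolynomial.X s : QPoly n)) hp) using 1
    rw [smul_sub, smul_sub]; abel

/-- **IN THE KERNEL ⟹ TANGENT**: a rational polynomial killed by `φ` has its gradient in the tangent plane. -/
theorem gradQ_mem_of_subst_eq_zero (h : AlongForms L φ y) {Q : QPoly n} (hQ : φ Q = 0) : gradQ Q y ∈ tangent L y := by
  have := gradQ_sub_gradQ_subst_mem h Q
  rwa [hQ, gradQ_zero, sub_zero] at this

/-- The integer gradient of `IsCertificate` is the rational gradient of the mapped polynomial. -/
theorem grad_int_eq_gradQ (P : MvPolynomial (Fin n ⊕ Fin n) ℤ) :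
    (fun s : Fin n ⊕ Fin n => MvPolynomial.aeval (Sum.elim y (cexp ∘ y)) (MvPolynomial.pderiv s P)) =
      gradQ (MvPolynomial.map (algebraMap ℤ ℚ) P) y := by
  funext s
  rw [gradQ, MvPolynomial.pderiv_map, MvPolynomial.aeval_map_algebraMap]
  rfl

/-- The tangent plane has dimension `≤ n`. -/
theorem finrank_tangent_le (L : Fin n → QPoly n) (y : Fin n → ℂ) :
    Module.finrank ℂ (tangent L y) ≤ n :=
  (finrank_range_le_card (R := ℂ) (fun k : Fin n => gradQ (L k) y)).trans (by simp)

/-- **NO SMALL CERTIFICATE AT AN EXCLUDED PRESENTED POINT.**  If `φ` is a substitution along forms vanishing at `(y, eʸ)`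
and every integer polynomial of size `≤ N` vanishing there is killed by `φ`, then no transverse integer certificate of size
`≤ N` exists at `y`: its `n + 1` gradients would be `ℂ`-independent vectors of the `≤ n`-dimensional tangent plane. -/
theorem no_certificate_of_substExcl (h : AlongForms L φ y) {N : ℕ} (hex : SubstExcl φ y N) :
    ¬ ∃ P : Fin (n + 1) → MvPolynomial (Fin n ⊕ Fin n) ℤ, (∀ i, psize (P i) ≤ N) ∧ IsCertificate n y P := by
  rintro ⟨P, hsize, hzero, hli⟩
  have hmem : ∀ i, gradQ (MvPolynomial.map (algebraMap ℤ ℚ) (P i)) y ∈ tangent L y := fun i =>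
    gradQ_mem_of_subst_eq_zero h (hex (P i) (hsize i) (hzero i))
  have hli' : LinearIndependent ℂ fun i => gradQ (MvPolynomial.map (algebraMap ℤ ℚ) (P i)) y := by
    have : (fun i => fun s : Fin n ⊕ Fin n =>
        MvPolynomial.aeval (Sum.elim y (cexp ∘ y)) (MvPolynomial.pderiv s (P i))) =
        fun i => gradQ (MvPolynomial.map (algebraMap ℤ ℚ) (P i)) y := funext fun i => grad_int_eq_gradQ (P i)
    rw [← this]; exact hli
  haveI : FiniteDimensional ℂ (tangent L y) := FiniteDimensional.span_of_finite ℂ (Set.finite_range _)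
  let b : Fin (n + 1) → tangent L y := fun i => ⟨gradQ (MvPolynomial.map (algebraMap ℤ ℚ) (P i)) y, hmem i⟩
  have hb : LinearIndependent ℂ b := LinearIndependent.of_comp (tangent L y).subtype hli'
  have h1 := hb.fintype_card_le_finrank
  have h2 := finrank_tangent_le L y
  rw [Fintype.card_fin] at h1
  omega

/-! ## §2 The certificates consume NOTHING: the cell instance under arbitrary binders, and the two readings of record -/

/-- **THE INSTRUMENT'S CELL INSTANCE, HYPOTHESIS-FREE.**  Whatever three hypotheses `H₁ H₂ H₃` an item puts in front
(`LowerRanks n` or `ConjLowerRanks n`, near-optimality, conjugation-stability — or anything else), the certified exclusion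
decides the instance: the binders are DISCARDED. -/
theorem cell_clean_of_substExcl (h : AlongForms L φ y) {N : ℕ} (hex : SubstExcl φ y N) (H₁ H₂ H₃ : Prop) :
    H₁ → H₂ → H₃ →
      (¬ LinearIndependent ℚ y ∨
        ¬ ∃ P : Fin (n + 1) → MvPolynomial (Fin n ⊕ Fin n) ℤ, (∀ i, psize (P i) ≤ N) ∧ IsCertificate n y P) :=
  fun _ _ _ => Or.inr (no_certificate_of_substExcl h hex)

/-- 1H READING: the `(n, c, y)`-instance of `FinCSAt g` (`g = stdGauge`: of the item `FinCS`, stmt-Schanuel-27287). -/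
theorem finCSAt_cell_of_substExcl (h : AlongForms L φ y) {g : ℕ → ℕ → ℕ} {c : ℕ} (hex : SubstExcl φ y (g n c)) :
    LowerRanks n → NearOpt n c y → ConjStable y →
      (¬ LinearIndependent ℚ y ∨
        ¬ ∃ P : Fin (n + 1) → MvPolynomial (Fin n ⊕ Fin n) ℤ, (∀ i, psize (P i) ≤ g n c) ∧ IsCertificate n y P) :=
  cell_clean_of_substExcl h hex _ _ _

/-- Σ READING: the `(n, c, y)`-instance of the sibling route's instrument `FinCSSigma` (= `RootDecomp1HMirror.FinCSσ` at
`g = stdGauge`) — the `σ`-lower ranks `ConjLowerRanks n` are discarded exactly like `LowerRanks n`. -/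
theorem finCSσAt_cell_of_substExcl (h : AlongForms L φ y) {g : ℕ → ℕ → ℕ} {c : ℕ} (hex : SubstExcl φ y (g n c)) :
    RootDecomp1HMirror.ConjLowerRanks n → NearOpt n c y → ConjStable y →
      (¬ LinearIndependent ℚ y ∨
        ¬ ∃ P : Fin (n + 1) → MvPolynomial (Fin n ⊕ Fin n) ℤ, (∀ i, psize (P i) ≤ g n c) ∧ IsCertificate n y P) :=
  cell_clean_of_substExcl h hex _ _ _

/-- THE RESIDUAL AT AN EXCLUDED POINT, READ EXACTLY (1H): the `(n, c, y)`-instance of `BridgeAt g` (for `g = stdGauge`: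
of `BridgeTransverse`, stmt-Schanuel-30564) is equivalent to «`LowerRanks n →` `y` is not a counterexample». -/
theorem bridge_cell_iff_subst (h : AlongForms L φ y) {g : ℕ → ℕ → ℕ} {c : ℕ} (hex : SubstExcl φ y (g n c))
    (hopt : NearOpt n c y) (hcs : ConjStable y) (hnh : ¬ InTowerHull y) :
    (LowerRanks n → NearOpt n c y → ConjStable y → CounterEx y → ¬ InTowerHull y →
        ∃ P : Fin (n + 1) → MvPolynomial (Fin n ⊕ Fin n) ℤ, (∀ i, psize (P i) ≤ g n c) ∧ IsCertificate n y P) ↔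
      (LowerRanks n → ¬ CounterEx y) := by
  constructor
  · exact fun hB hlow hce => no_certificate_of_substExcl h hex (hB hlow hopt hcs hce hnh)
  · exact fun hN hlow _ _ hce _ => absurd hce (hN hlow)

/-- … and the Σ reading of the sibling residual `BridgeTransverseSigma` at an excluded point: «`ConjLowerRanks n →` `y` is
not a counterexample» — the `σ`-lower ranks pass through untouched. -/
theorem bridgeσ_cell_iff_subst (h : AlongForms L φ y) {g : ℕ → ℕ → ℕ} {c : ℕ} (hex : SubstExcl φ y (g n c))
    (hopt : NearOpt n c y) (hcs : ConjStable y) (hnh : ¬ InTowerHull y) :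
    (RootDecomp1HMirror.ConjLowerRanks n → NearOpt n c y → ConjStable y → CounterEx y → ¬ InTowerHull y →
        ∃ P : Fin (n + 1) → MvPolynomial (Fin n ⊕ Fin n) ℤ, (∀ i, psize (P i) ≤ g n c) ∧ IsCertificate n y P) ↔
      (RootDecomp1HMirror.ConjLowerRanks n → ¬ CounterEx y) := by
  constructor
  · exact fun hB hlow hce => no_certificate_of_substExcl h hex (hB hlow hopt hcs hce hnh)
  · exact fun hN hlow _ _ hce _ => absurd hce (hN hlow)

/-! ## §3 Ranks ≤ 2 are settled by the structural binders (the instrument's rank-2 cells are off the cone's critical path) -/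

/-- **Under `ProductSchanuel ∧ RelTowerSchanuel`, Schanuel's conjecture HOLDS in every rank `≤ 2`**: a rank-`≤ 2`
counterexample is itself a `ℚ`-free tower tuple (`towerTuple_of_counterEx_rank_le_two`, hypothesis-free) and the hull
theorem (`not_lt_of_inTowerHull`) forbids `ℚ`-free tower tuples to be counterexamples. -/
theorem schanuelRank_of_structural_of_le_two (hPS : ProductSchanuel) (hRT : RelTowerSchanuel) {m : ℕ} (hm : m ≤ 2) :
    SchanuelRank m := by
  intro z hz
  by_contra hlt
  have hce : CounterEx z := ⟨hz, not_le.1 hlt⟩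
  exact not_lt_of_inTowerHull hPS hRT hz
    ⟨m, z, hz, towerTuple_of_counterEx_rank_le_two hm hce, fun j => Submodule.subset_span ⟨j, rfl⟩⟩ hce.2

/-- Hence the structural binders give the lower ranks of rank `3` outright … -/
theorem lowerRanks_three_of_structural (hPS : ProductSchanuel) (hRT : RelTowerSchanuel) : LowerRanks 3 :=
  fun m hm => schanuelRank_of_structural_of_le_two hPS hRT (by omega)

/-- … and the `σ`-lower ranks of rank `3` (sibling route). -/
theorem conjLowerRanks_three_of_structural (hPS : ProductSchanuel) (hRT : RelTowerSchanuel) :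
    RootDecomp1HMirror.ConjLowerRanks 3 :=
  RootDecomp1HMirror.conjLowerRanks_of_lowerRanks (lowerRanks_three_of_structural hPS hRT)

/-- **RANK-≤ 2 CELLS ARE CONSUMED ONLY VACUOUSLY**: under the structural binders there is no rank-`≤ 2` counterexample at
all, so every rank-`≤ 2` instance of the instrument (`FinCS` / `FinCSSigma`, any cell `(m, c)`, `m ≤ 2`) that the deciding
theorems invoke sits on a branch already closed — the load-bearing instrument frontier is rank `3`. -/
theorem no_counterEx_of_structural_of_le_two (hPS : ProductSchanuel) (hRT : RelTowerSchanuel) {m : ℕ} (hm : m ≤ 2)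
    (z : Fin m → ℂ) : ¬ CounterEx z :=
  fun hce => (not_le.2 hce.2) (schanuelRank_of_structural_of_le_two hPS hRT hm z hce.1)

/-- **AT RANK 3 THE LOWER-RANK BINDER IS FREE** under the structural binders: for any reading `R` of a rank-`3` instance
(of `BridgeTransverse`, `FinCS`, or their Σ siblings), `LowerRanks 3 → R` and `R` are equivalent given `ProductSchanuel ∧
RelTowerSchanuel` — the rank-`3` layer of the residual is, inside the cone, Schanuel at presented sharp triples OUTRIGHT. -/
theorem lowerRanks_three_binder_free (hPS : ProductSchanuel) (hRT : RelTowerSchanuel) (R : Prop) :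
    (LowerRanks 3 → R) ↔ R :=
  ⟨fun h => h (lowerRanks_three_of_structural hPS hRT), fun h _ => h⟩

/-- … and the same for the `σ`-lower ranks of the sibling route. -/
theorem conjLowerRanks_three_binder_free (hPS : ProductSchanuel) (hRT : RelTowerSchanuel) (R : Prop) :
    (RootDecomp1HMirror.ConjLowerRanks 3 → R) ↔ R :=
  ⟨fun h => h (conjLowerRanks_three_of_structural hPS hRT), fun h _ => h⟩

/-! ## §4 The imaginary-axis pin (which σ-stable non-real points a size-1 cell can have) -/

/-- **THE IMAGINARY-AXIS PIN.**  `a θ + b sin θ = 0` with `a, b ∈ {0, ±1}` not both zero and `θ ≠ 0` forces `a = 0` and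
`sin θ = 0` (since `|sin θ| < |θ|`).  This is the imaginary part of a size-`1` form `a·y + b·eʸ + c` at a point whose
coordinates are real except `y₃ = iθ`: such a form pins `y₃` to `iπℤ ∖ {0}` (so `e^{y₃} = ±1`, a depth-one element of the
span, a hull point) and does not contain `y₃` linearly. -/
theorem imagAxis_pin {θ a b : ℝ} (hθ : θ ≠ 0) (ha : a = 0 ∨ a = 1 ∨ a = -1) (hb : b = 0 ∨ b = 1 ∨ b = -1)
    (hab : ¬ (a = 0 ∧ b = 0)) (h : a * θ + b * Real.sin θ = 0) : a = 0 ∧ Real.sin θ = 0 := by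
  have hlt := Real.abs_sin_lt_abs hθ
  rcases ha with rfl | rfl | rfl
  · refine ⟨rfl, ?_⟩
    rcases hb with rfl | rfl | rfl
    · exact absurd ⟨rfl, rfl⟩ hab
    · simpa using h
    · have : -Real.sin θ = 0 := by simpa using h
      exact neg_eq_zero.1 this
  · exfalso
    have e : -(b * Real.sin θ) = θ := by linarith
    have hle : |θ| ≤ |Real.sin θ| :=
      calc |θ| = |-(b * Real.sin θ)| := by rw [e]
        _ = |b| * |Real.sin θ| := by rw [abs_neg, abs_mul]
        _ ≤ |Real.sin θ| := by rcases hb with rfl | rfl | rfl <;> simp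
    exact absurd hlt (not_lt.2 hle)
  · exfalso
    have e : b * Real.sin θ = θ := by linarith
    have hle : |θ| ≤ |Real.sin θ| :=
      calc |θ| = |b * Real.sin θ| := by rw [e]
        _ = |b| * |Real.sin θ| := abs_mul _ _
        _ ≤ |Real.sin θ| := by rcases hb with rfl | rfl | rfl <;> simp
    exact absurd hlt (not_lt.2 hle)

/-- … so `θ ∈ πℤ`: the imaginary-axis coordinate is an integer multiple of `iπ`. -/
theorem imagAxis_pin_pi {θ a b : ℝ} (hθ : θ ≠ 0) (ha : a = 0 ∨ a = 1 ∨ a = -1) (hb : b = 0 ∨ b = 1 ∨ b = -1)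
    (hab : ¬ (a = 0 ∧ b = 0)) (h : a * θ + b * Real.sin θ = 0) : ∃ k : ℤ, (k : ℝ) * Real.pi = θ :=
  Real.sin_eq_zero_iff.1 (imagAxis_pin hθ ha hb hab h).2

/-- The imaginary part of a size-`1` form at a point `(x₁, x₂, iθ)` with `x₁, x₂, θ` real IS `a₃ θ + b₃ sin θ`. -/
theorem im_form_realReal_imag (x₁ x₂ θ a₁ a₂ a₃ b₁ b₂ b₃ c : ℝ) :
    ((a₁ : ℂ) * x₁ + a₂ * x₂ + a₃ * (I * θ) + b₁ * cexp x₁ + b₂ * cexp x₂ + b₃ * cexp (I * θ) + c).im =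
      a₃ * θ + b₃ * Real.sin θ := by
  have h1 : (cexp (x₁ : ℂ)).im = 0 := by rw [← Complex.ofReal_exp]; exact Complex.ofReal_im _
  have h2 : (cexp (x₂ : ℂ)).im = 0 := by rw [← Complex.ofReal_exp]; exact Complex.ofReal_im _
  have h3 : (cexp (I * θ)).im = Real.sin θ := by
    rw [mul_comm, Complex.exp_mul_I]
    simp [Complex.cos_ofReal_im, Complex.sin_ofReal_re]
  have h1' : (cexp (x₁ : ℂ)).re = Real.exp x₁ := by rw [← Complex.ofReal_exp]; exact Complex.ofReal_re _
  simp [h1, h2, h3, Complex.mul_im, Complex.add_im]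

end Summit.Schanuel.Schanuel.Theorems.RootDecomp1HSubst
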